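import Summits.Ventures.LatticeQCDFlow.Scoring.TorusWilsonLoopLimit2D
import Summits.Ventures.LatticeQCDFlow.Scoring.InfiniteVolumeLimit2D
import Summits.Ventures.LatticeQCDFlow.Scoring.UNOnePlaquettePlaquetteRange
import Literature.MathematicalPhysics.QuantumLattice.WilsonLoopsProofs
import HarnessLib

/-!
# The exact non-abelian area law in two dimensions, V-l: Wilson loops, static potential and the EXACT STRING TENSION of the infinite-volume state; `U(N)` confines at every `β ≠ 0`

HONEST FRAMING: exact (Metropolis-corrected) sampling algorithms for lattice gauge theory;
figures of merit are autocorrelation/cost numbers at stated couplings and volumes; no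
continuum-physics claim.

Venture `LatticeQCDFlow` (cell pub-lqcd), sub-topic `Scoring`; FANOUT row 5 (`s0-sun-a`), GEN-19.
NEW WORK of the cell (placement rule).  Vocabulary of `Literature…QuantumLattice.WilsonLoops` (S12 of the
constructive-QFT inventory): `rectExpectation μ χ 0 1 R T` (the `R × T` Wilson loop of a state `μ` on
`G^{edges(ℤ^d)}`), `HasStaticPotential`, `HasStringTension` (iterated), `HasStringTension'` (joint),
`IsConfining`, `HasAreaLawWith` / `HasAreaLawState`; `d = 2`, every real `β`.

* §1 **`rectExpectation_eq_re_pow_of_mem`** — every compact second-countable `G`, continuous `ρ` with scalar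
  one-plaquette matrix `c·1`: for EVERY infinite-volume limit point `μ ∈ infiniteVolumeLimitPoints ρ β` and
  `R, T ≥ 1`, `W_μ(R,T) = Re((c/m)^{RT})` (V-i's torus limit + `WilsonLoopsProofs.tendsto_wilsonExpectation_wilsonLoop`);
* §2 bookkeeping for a state with `W(R,T) = P^{RT}`, `P ≠ 0`: `hasStaticPotential_of_rectExpectation_eq_pow`
  (`V(R) = −R log|P|`), `hasStringTension_of_rectExpectation_eq_pow` (`σ = −log|P|`), the joint form
  `hasStringTension'_of_rectExpectation_eq_pow`, `hasAreaLawWith_of_rectExpectation_eq_pow` (`C = 1`, equality),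
  and for `|P| < 1`: `hasAreaLawState_…`, `isConfining_…`;
* §3 **`U(N)`, EVERY `N ≥ 1`, EVERY REAL `β`**: for every infinite-volume limit point `μ` (there is exactly one,
  V-k) `W_μ(R,T) = P_N(β)^{RT}` (`unitary_rectExpectation_eq`), `P_N(β)` the one-plaquette plaquette
  (`= N⁻¹(log det[I_{|i−j|}])′(β)`, GEN-17); for `β ≠ 0`: the static potential is EXACTLY LINEAR,
  `V(R) = −R log|P_N(β)|` (`unitary_hasStaticPotential`), THE STRING TENSION EXISTS AND EQUALS `−log|P_N(β)| > 0`
  in the iterated and in the joint sense (`unitary_hasStringTension`, `unitary_hasStringTension'`), the state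
  CONFINES (`unitary_isConfining`) and obeys the area law with `C = 1`, `c = σ` (`unitary_hasAreaLawState`); at
  `β = 0` all loops vanish (`unitary_rectExpectation_eq_zero`).  **`unitary_infiniteVolume_confinement`**: the
  package for THE infinite-volume limit `μ_β` of V-k.

Published form: Gross–Witten 1980 §II (`σ = −log w`, `w = ⟨N⁻¹ tr U_p⟩`); the tree's S12 named facts
`exists_hasStaticPotential` / `exists_hasStringTension` (all `d ≥ 2`, from reflection positivity) are here
EXACT EQUALITIES in `d = 2`.  No `def`, nothing cited as a fact, 0 sorry.
-/

noncomputable section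

open MeasureTheory Function Finset Filter Topology
open Literature.MathematicalPhysics.QuantumFieldTheory
open Literature.MathematicalPhysics.QuantumLattice
open Summit.Ventures.LatticeQCDFlow.Theory2.Lattice
open Summit.Ventures.LatticeQCDFlow.Theory2.Lattice.TwoDim

namespace Summit.Ventures.LatticeQCDFlow.Scoring

/-! ## §1. The Wilson loops of every infinite-volume limit point -/

section General

variable {G : Type*} [Group G] [TopologicalSpace G] [IsTopologicalGroup G]
  [CompactSpace G] [SecondCountableTopology G] [MeasurableSpace G] [BorelSpace G] {N : ℕ}
  (ρ : G →* Matrix (Fin N) (Fin N) ℂ)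

/-- **THE WILSON LOOPS OF EVERY INFINITE-VOLUME LIMIT POINT OF TWO-DIMENSIONAL LATTICE YANG–MILLS** (every
compact second-countable `G`, continuous `ρ` with scalar one-plaquette matrix `∫ ρ(g) e^{−β(N−Re tr ρ(g))} dg = c·1`,
every real `β`, `R, T ≥ 1`): `W_μ(R, T) = Re((c/m)^{RT})`, `m = ∫ e^{−β(N−Re tr ρ)} dHaar`. -/
theorem rectExpectation_eq_re_pow_of_mem [NeZero N] (hρ : Continuous ρ) {β : ℝ} {c : ℂ}
    (hM : (Matrix.of fun k l : Fin N => ∫ g, ρ g k l *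
      (Real.exp (-(β * ((N : ℝ) - (ρ g).trace.re))) : ℂ) ∂(haarProbability G)) =
        c • (1 : Matrix (Fin N) (Fin N) ℂ))
    {μ : Measure (LGConfig 2 G)} (hμ : μ ∈ infiniteVolumeLimitPoints ρ β) {R T : ℕ} (hR1 : 1 ≤ R)
    (hT1 : 1 ≤ T) :
    rectExpectation μ (fun g => normalisedCharacter N (ρ g)) 0 1 R T =
      ((c / ∫ g, Real.exp (-(β * ((N : ℝ) - (ρ g).trace.re))) ∂(haarProbability G)) ^ (R * T)).re := by
  obtain ⟨Ls, hLs, hlim⟩ := hμ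
  have hA := tendsto_wilsonExpectation_wilsonLoop ρ hρ hlim R T
  have hB := (tendsto_wilsonExpectation_loop ρ hρ β hM hR1 hT1
    (fun L => (0 : Site 2 (L + 1)))).comp hLs.tendsto_atTop
  exact tendsto_nhds_unique hA hB

end General

/-! ## §2. States with `W(R,T) = P^{RT}`: static potential, string tension, area law -/

section PowerLaw

variable {d : ℕ} [NeZero d] {G : Type*} [Group G] [MeasurableSpace G] {μ : Measure (LGConfig d G)}
  {χ : G → ℝ} {P : ℝ}

/-- `W(R,T) = P^{RT}` with `P ≠ 0`: the static potential at separation `R` exists and is `−R log|P|`. -/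
theorem hasStaticPotential_of_rectExpectation_eq_pow (hP : P ≠ 0) (R : ℕ)
    (h : ∀ T, 1 ≤ T → rectExpectation μ χ 0 1 R T = P ^ (R * T)) :
    HasStaticPotential μ χ R (-(R * Real.log |P|)) := by
  refine ⟨?_, ?_⟩
  · filter_upwards [Filter.eventually_ge_atTop 1] with T hT
    rw [h T hT]
    exact pow_ne_zero _ hP
  · refine (tendsto_const_nhds (x := -((R : ℝ) * Real.log |P|))).congr' ?_
    filter_upwards [Filter.eventually_ge_atTop 1] with T hT
    have hT0 : (T : ℝ) ≠ 0 := Nat.cast_ne_zero.2 (by omega)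
    rw [h T hT, abs_pow, Real.log_pow, Nat.cast_mul]
    field_simp

/-- `W(R,T) = P^{RT}` with `P ≠ 0`: the string tension exists (iterated form) and equals `−log|P|`. -/
theorem hasStringTension_of_rectExpectation_eq_pow (hP : P ≠ 0)
    (h : ∀ R T, 1 ≤ R → 1 ≤ T → rectExpectation μ χ 0 1 R T = P ^ (R * T)) :
    HasStringTension μ χ (-Real.log |P|) := by
  refine ⟨fun R => -((R : ℝ) * Real.log |P|), fun R hR =>
    hasStaticPotential_of_rectExpectation_eq_pow hP R fun T hT => h R T hR hT, ?_⟩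
  refine (tendsto_const_nhds (x := -Real.log |P|)).congr' ?_
  filter_upwards [Filter.eventually_ge_atTop 1] with R hR
  have hR0 : (R : ℝ) ≠ 0 := Nat.cast_ne_zero.2 (by omega)
  field_simp

/-- `W(R,T) = P^{RT}` with `P ≠ 0`: the string tension exists in the JOINT form, `−log|W(R,T)|/(RT) → −log|P|`
as `(R,T) → ∞` (indeed the quotient is constant). -/
theorem hasStringTension'_of_rectExpectation_eq_pow (hP : P ≠ 0)
    (h : ∀ R T, 1 ≤ R → 1 ≤ T → rectExpectation μ χ 0 1 R T = P ^ (R * T)) :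
    HasStringTension' μ χ (-Real.log |P|) := by
  refine ⟨?_, ?_⟩
  · filter_upwards [Filter.eventually_ge_atTop ((1, 1) : ℕ × ℕ)] with p hp
    rw [h p.1 p.2 hp.1 hp.2]
    exact pow_ne_zero _ hP
  · refine (tendsto_const_nhds (x := -Real.log |P|)).congr' ?_
    filter_upwards [Filter.eventually_ge_atTop ((1, 1) : ℕ × ℕ)] with p hp
    have h1 : (p.1 : ℝ) ≠ 0 := Nat.cast_ne_zero.2 (by have := hp.1; omega)
    have h2 : (p.2 : ℝ) ≠ 0 := Nat.cast_ne_zero.2 (by have := hp.2; omega)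
    rw [h p.1 p.2 hp.1 hp.2, abs_pow, Real.log_pow, Nat.cast_mul]
    field_simp

/-- `W(R,T) = P^{RT}` with `P ≠ 0`: the area-law bound holds with `C = 1`, `c = −log|P|` (with equality). -/
theorem hasAreaLawWith_of_rectExpectation_eq_pow (hP : P ≠ 0)
    (h : ∀ R T, 1 ≤ R → 1 ≤ T → rectExpectation μ χ 0 1 R T = P ^ (R * T)) :
    HasAreaLawWith μ χ 1 (-Real.log |P|) := by
  intro R T hR hT
  rw [h R T hR hT, one_pow, one_mul, abs_pow, neg_neg,
    show Real.log |P| * R * T = ((R * T : ℕ) : ℝ) * Real.log |P| by push_cast; ring,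
    Real.exp_nat_mul, Real.exp_log (abs_pos.2 hP)]

/-- `W(R,T) = P^{RT}` with `0 < |P| < 1`: the state obeys an area law (`HasAreaLawState`). -/
theorem hasAreaLawState_of_rectExpectation_eq_pow (hP : P ≠ 0) (hP1 : |P| < 1)
    (h : ∀ R T, 1 ≤ R → 1 ≤ T → rectExpectation μ χ 0 1 R T = P ^ (R * T)) :
    HasAreaLawState μ χ :=
  ⟨1, -Real.log |P|, neg_pos.2 (Real.log_neg (abs_pos.2 hP) hP1),
    hasAreaLawWith_of_rectExpectation_eq_pow hP h⟩

/-- `W(R,T) = P^{RT}` with `0 < |P| < 1`: the state CONFINES, with string tension `−log|P| > 0`. -/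
theorem isConfining_of_rectExpectation_eq_pow (hP : P ≠ 0) (hP1 : |P| < 1)
    (h : ∀ R T, 1 ≤ R → 1 ≤ T → rectExpectation μ χ 0 1 R T = P ^ (R * T)) :
    IsConfining μ χ :=
  ⟨-Real.log |P|, neg_pos.2 (Real.log_neg (abs_pos.2 hP) hP1),
    hasStringTension_of_rectExpectation_eq_pow hP h⟩

end PowerLaw

/-! ## §3. `U(N)`: exact Wilson loops, linear static potential, string tension `−log|P_N(β)|`, confinement -/

section Unitary

/-- **THE WILSON LOOPS OF THE INFINITE-VOLUME 2-d `U(N)` THEORY, EVERY `N ≥ 1`, EVERY REAL `β`**: for every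
infinite-volume limit point `μ` and `R, T ≥ 1`, `W_μ(R,T) = P_N(β)^{RT}`, `P_N(β)` the one-plaquette plaquette. -/
theorem unitary_rectExpectation_eq (N : ℕ) [NeZero N] (β : ℝ) {μ : Measure (LGConfig 2 (Matrix.unitaryGroup (Fin N) ℂ))}
    (hμ : μ ∈ infiniteVolumeLimitPoints (unitaryFundamentalRep (Fin N) ℂ) β) {R T : ℕ} (hR1 : 1 ≤ R)
    (hT1 : 1 ≤ T) :
    rectExpectation μ (fun g => normalisedCharacter N (unitaryFundamentalRep (Fin N) ℂ g)) 0 1 R T =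
      ((∫ u, ((u : Matrix.unitaryGroup (Fin N) ℂ) : Matrix (Fin N) (Fin N) ℂ).trace.re / N *
            Real.exp (-(β * ((N : ℝ) -
              ((u : Matrix.unitaryGroup (Fin N) ℂ) : Matrix (Fin N) (Fin N) ℂ).trace.re)))
            ∂(haarProbability (Matrix.unitaryGroup (Fin N) ℂ))) /
          (∫ u, Real.exp (-(β * ((N : ℝ) -
              ((u : Matrix.unitaryGroup (Fin N) ℂ) : Matrix (Fin N) (Fin N) ℂ).trace.re)))
            ∂(haarProbability (Matrix.unitaryGroup (Fin N) ℂ)))) ^ (R * T) := by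
  obtain ⟨Ls, hLs, hlim⟩ := hμ
  have hA := tendsto_wilsonExpectation_wilsonLoop (unitaryFundamentalRep (Fin N) ℂ)
    (continuous_unitaryFundamentalRep (Fin N) ℂ) hlim R T
  have hB := (unitary_tendsto_wilsonExpectation_loop N β hR1 hT1
    (fun L => (0 : Site 2 (L + 1)))).comp hLs.tendsto_atTop
  exact tendsto_nhds_unique hA hB

/-- At `β = 0` every Wilson loop of every infinite-volume limit point of 2-d `U(N)` vanishes (`R, T ≥ 1`). -/
theorem unitary_rectExpectation_eq_zero (N : ℕ) [NeZero N] {μ : Measure (LGConfig 2 (Matrix.unitaryGroup (Fin N) ℂ))}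
    (hμ : μ ∈ infiniteVolumeLimitPoints (unitaryFundamentalRep (Fin N) ℂ) 0) {R T : ℕ} (hR1 : 1 ≤ R)
    (hT1 : 1 ≤ T) :
    rectExpectation μ (fun g => normalisedCharacter N (unitaryFundamentalRep (Fin N) ℂ g)) 0 1 R T = 0 := by
  rw [unitary_rectExpectation_eq N 0 hμ hR1 hT1, unitary_plaquette_zero,
    zero_pow (Nat.mul_ne_zero (by omega) (by omega))]

/-- `P_N(β) ≠ 0` and `|P_N(β)| < 1` for `β ≠ 0` (`N ≥ 1`; GEN-17's `−1 < P_N < 1`, strict monotonicity, `P_N(0) = 0`). -/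
theorem unitary_plaquette_ne_zero_abs_lt_one (N : ℕ) [NeZero N] {β : ℝ} (hβ : β ≠ 0) :
    (∫ u, ((u : Matrix.unitaryGroup (Fin N) ℂ) : Matrix (Fin N) (Fin N) ℂ).trace.re / N *
          Real.exp (-(β * ((N : ℝ) - ((u : Matrix.unitaryGroup (Fin N) ℂ) : Matrix (Fin N) (Fin N) ℂ).trace.re)))
        ∂(haarProbability (Matrix.unitaryGroup (Fin N) ℂ)))
      / (∫ u, Real.exp (-(β * ((N : ℝ) - ((u : Matrix.unitaryGroup (Fin N) ℂ) :
          Matrix (Fin N) (Fin N) ℂ).trace.re))) ∂(haarProbability (Matrix.unitaryGroup (Fin N) ℂ))) ≠ 0 ∧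
    |(∫ u, ((u : Matrix.unitaryGroup (Fin N) ℂ) : Matrix (Fin N) (Fin N) ℂ).trace.re / N *
          Real.exp (-(β * ((N : ℝ) - ((u : Matrix.unitaryGroup (Fin N) ℂ) : Matrix (Fin N) (Fin N) ℂ).trace.re)))
        ∂(haarProbability (Matrix.unitaryGroup (Fin N) ℂ)))
      / (∫ u, Real.exp (-(β * ((N : ℝ) - ((u : Matrix.unitaryGroup (Fin N) ℂ) :
          Matrix (Fin N) (Fin N) ℂ).trace.re))) ∂(haarProbability (Matrix.unitaryGroup (Fin N) ℂ)))| < 1 := by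
  refine ⟨?_, abs_lt.2 ⟨neg_one_lt_unitary_plaquette N β, unitary_plaquette_lt_one N β⟩⟩
  rcases lt_or_gt_of_ne hβ with hlt | hgt
  · have h := strictMono_unitary_plaquette N hlt
    dsimp only at h
    rw [unitary_plaquette_zero] at h
    exact h.ne
  · exact (unitary_plaquette_pos N hgt).ne'

/-- **THE STATIC POTENTIAL OF INFINITE-VOLUME 2-d `U(N)` IS EXACTLY LINEAR**: for `β ≠ 0`, every
infinite-volume limit point `μ` and every `R ≥ 1`, `V_μ(R) = −R log|P_N(β)|` (`HasStaticPotential`). -/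
theorem unitary_hasStaticPotential (N : ℕ) [NeZero N] {β : ℝ} (hβ : β ≠ 0)
    {μ : Measure (LGConfig 2 (Matrix.unitaryGroup (Fin N) ℂ))}
    (hμ : μ ∈ infiniteVolumeLimitPoints (unitaryFundamentalRep (Fin N) ℂ) β) {R : ℕ} (hR1 : 1 ≤ R) :
    HasStaticPotential μ (fun g => normalisedCharacter N (unitaryFundamentalRep (Fin N) ℂ g)) R
      (-(R * Real.log |(∫ u, ((u : Matrix.unitaryGroup (Fin N) ℂ) : Matrix (Fin N) (Fin N) ℂ).trace.re / N *
          Real.exp (-(β * ((N : ℝ) - ((u : Matrix.unitaryGroup (Fin N) ℂ) : Matrix (Fin N) (Fin N) ℂ).trace.re)))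
        ∂(haarProbability (Matrix.unitaryGroup (Fin N) ℂ)))
      / (∫ u, Real.exp (-(β * ((N : ℝ) - ((u : Matrix.unitaryGroup (Fin N) ℂ) :
          Matrix (Fin N) (Fin N) ℂ).trace.re))) ∂(haarProbability (Matrix.unitaryGroup (Fin N) ℂ)))|)) :=
  hasStaticPotential_of_rectExpectation_eq_pow (unitary_plaquette_ne_zero_abs_lt_one N hβ).1 R
    fun _ hT => unitary_rectExpectation_eq N β hμ hR1 hT

/-- **THE STRING TENSION OF INFINITE-VOLUME 2-d `U(N)` LATTICE YANG–MILLS EXISTS AND EQUALS `−log|P_N(β)|`**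
(`β ≠ 0`, every `N ≥ 1`, every infinite-volume limit point; iterated form `HasStringTension`). -/
theorem unitary_hasStringTension (N : ℕ) [NeZero N] {β : ℝ} (hβ : β ≠ 0)
    {μ : Measure (LGConfig 2 (Matrix.unitaryGroup (Fin N) ℂ))}
    (hμ : μ ∈ infiniteVolumeLimitPoints (unitaryFundamentalRep (Fin N) ℂ) β) :
    HasStringTension μ (fun g => normalisedCharacter N (unitaryFundamentalRep (Fin N) ℂ g))
      (-Real.log |(∫ u, ((u : Matrix.unitaryGroup (Fin N) ℂ) : Matrix (Fin N) (Fin N) ℂ).trace.re / N *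
          Real.exp (-(β * ((N : ℝ) - ((u : Matrix.unitaryGroup (Fin N) ℂ) : Matrix (Fin N) (Fin N) ℂ).trace.re)))
        ∂(haarProbability (Matrix.unitaryGroup (Fin N) ℂ)))
      / (∫ u, Real.exp (-(β * ((N : ℝ) - ((u : Matrix.unitaryGroup (Fin N) ℂ) :
          Matrix (Fin N) (Fin N) ℂ).trace.re))) ∂(haarProbability (Matrix.unitaryGroup (Fin N) ℂ)))|) :=
  hasStringTension_of_rectExpectation_eq_pow (unitary_plaquette_ne_zero_abs_lt_one N hβ).1
    fun _ _ hR hT => unitary_rectExpectation_eq N β hμ hR hT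

/-- The joint-limit form of the string tension also holds exactly for infinite-volume 2-d `U(N)` (`β ≠ 0`). -/
theorem unitary_hasStringTension' (N : ℕ) [NeZero N] {β : ℝ} (hβ : β ≠ 0)
    {μ : Measure (LGConfig 2 (Matrix.unitaryGroup (Fin N) ℂ))}
    (hμ : μ ∈ infiniteVolumeLimitPoints (unitaryFundamentalRep (Fin N) ℂ) β) :
    HasStringTension' μ (fun g => normalisedCharacter N (unitaryFundamentalRep (Fin N) ℂ g))
      (-Real.log |(∫ u, ((u : Matrix.unitaryGroup (Fin N) ℂ) : Matrix (Fin N) (Fin N) ℂ).trace.re / N *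
          Real.exp (-(β * ((N : ℝ) - ((u : Matrix.unitaryGroup (Fin N) ℂ) : Matrix (Fin N) (Fin N) ℂ).trace.re)))
        ∂(haarProbability (Matrix.unitaryGroup (Fin N) ℂ)))
      / (∫ u, Real.exp (-(β * ((N : ℝ) - ((u : Matrix.unitaryGroup (Fin N) ℂ) :
          Matrix (Fin N) (Fin N) ℂ).trace.re))) ∂(haarProbability (Matrix.unitaryGroup (Fin N) ℂ)))|) :=
  hasStringTension'_of_rectExpectation_eq_pow (unitary_plaquette_ne_zero_abs_lt_one N hβ).1
    fun _ _ hR hT => unitary_rectExpectation_eq N β hμ hR hT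

/-- **INFINITE-VOLUME TWO-DIMENSIONAL `U(N)` LATTICE YANG–MILLS CONFINES AT EVERY `β ≠ 0`** (every `N ≥ 1`,
every infinite-volume limit point): positive string tension `−log|P_N(β)|`. -/
theorem unitary_isConfining (N : ℕ) [NeZero N] {β : ℝ} (hβ : β ≠ 0)
    {μ : Measure (LGConfig 2 (Matrix.unitaryGroup (Fin N) ℂ))}
    (hμ : μ ∈ infiniteVolumeLimitPoints (unitaryFundamentalRep (Fin N) ℂ) β) :
    IsConfining μ (fun g => normalisedCharacter N (unitaryFundamentalRep (Fin N) ℂ g)) :=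
  isConfining_of_rectExpectation_eq_pow (unitary_plaquette_ne_zero_abs_lt_one N hβ).1
    (unitary_plaquette_ne_zero_abs_lt_one N hβ).2 fun _ _ hR hT => unitary_rectExpectation_eq N β hμ hR hT

/-- The infinite-volume 2-d `U(N)` state obeys the area law `|W(R,T)| ≤ e^{−σRT}` (`C = 1`, `σ = −log|P_N(β)| > 0`)
for `β ≠ 0` (`HasAreaLawState`). -/
theorem unitary_hasAreaLawState (N : ℕ) [NeZero N] {β : ℝ} (hβ : β ≠ 0)
    {μ : Measure (LGConfig 2 (Matrix.unitaryGroup (Fin N) ℂ))}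
    (hμ : μ ∈ infiniteVolumeLimitPoints (unitaryFundamentalRep (Fin N) ℂ) β) :
    HasAreaLawState μ (fun g => normalisedCharacter N (unitaryFundamentalRep (Fin N) ℂ g)) :=
  hasAreaLawState_of_rectExpectation_eq_pow (unitary_plaquette_ne_zero_abs_lt_one N hβ).1
    (unitary_plaquette_ne_zero_abs_lt_one N hβ).2 fun _ _ hR hT => unitary_rectExpectation_eq N β hμ hR hT

/-- **CONFINEMENT OF INFINITE-VOLUME TWO-DIMENSIONAL `U(N)` LATTICE YANG–MILLS — THE PACKAGE** (every `N ≥ 1`,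
every real `β ≠ 0`): THE infinite-volume limit `μ_β` of the torus Wilson states exists and is the unique limit
point (V-k), its Wilson loops are `W(R,T) = P_N(β)^{RT}`, and it confines with the exact string tension
`σ_N(β) = −log|P_N(β)| > 0` (iterated and joint forms) and the area law with `C = 1`. -/
theorem unitary_infiniteVolume_confinement (N : ℕ) [NeZero N] {β : ℝ} (hβ : β ≠ 0) :
    ∃ μ : Measure (LGConfig 2 (Matrix.unitaryGroup (Fin N) ℂ)),
      Literature.MathematicalPhysics.QuantumLattice.IsInfiniteVolumeLimit (unitaryFundamentalRep (Fin N) ℂ) β μ ∧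
      infiniteVolumeLimitPoints (unitaryFundamentalRep (Fin N) ℂ) β = {μ} ∧
      (∀ R T : ℕ, 1 ≤ R → 1 ≤ T →
        rectExpectation μ (fun g => normalisedCharacter N (unitaryFundamentalRep (Fin N) ℂ g)) 0 1 R T =
          ((∫ u, ((u : Matrix.unitaryGroup (Fin N) ℂ) : Matrix (Fin N) (Fin N) ℂ).trace.re / N *
                Real.exp (-(β * ((N : ℝ) -
                  ((u : Matrix.unitaryGroup (Fin N) ℂ) : Matrix (Fin N) (Fin N) ℂ).trace.re)))
                ∂(haarProbability (Matrix.unitaryGroup (Fin N) ℂ))) /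
              (∫ u, Real.exp (-(β * ((N : ℝ) -
                  ((u : Matrix.unitaryGroup (Fin N) ℂ) : Matrix (Fin N) (Fin N) ℂ).trace.re)))
                ∂(haarProbability (Matrix.unitaryGroup (Fin N) ℂ)))) ^ (R * T)) ∧
      IsConfining μ (fun g => normalisedCharacter N (unitaryFundamentalRep (Fin N) ℂ g)) ∧
      HasStringTension μ (fun g => normalisedCharacter N (unitaryFundamentalRep (Fin N) ℂ g))
        (-Real.log |(∫ u, ((u : Matrix.unitaryGroup (Fin N) ℂ) : Matrix (Fin N) (Fin N) ℂ).trace.re / N *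
            Real.exp (-(β * ((N : ℝ) - ((u : Matrix.unitaryGroup (Fin N) ℂ) : Matrix (Fin N) (Fin N) ℂ).trace.re)))
          ∂(haarProbability (Matrix.unitaryGroup (Fin N) ℂ)))
        / (∫ u, Real.exp (-(β * ((N : ℝ) - ((u : Matrix.unitaryGroup (Fin N) ℂ) :
            Matrix (Fin N) (Fin N) ℂ).trace.re))) ∂(haarProbability (Matrix.unitaryGroup (Fin N) ℂ)))|) ∧
      HasStringTension' μ (fun g => normalisedCharacter N (unitaryFundamentalRep (Fin N) ℂ g))
        (-Real.log |(∫ u, ((u : Matrix.unitaryGroup (Fin N) ℂ) : Matrix (Fin N) (Fin N) ℂ).trace.re / N *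
            Real.exp (-(β * ((N : ℝ) - ((u : Matrix.unitaryGroup (Fin N) ℂ) : Matrix (Fin N) (Fin N) ℂ).trace.re)))
          ∂(haarProbability (Matrix.unitaryGroup (Fin N) ℂ)))
        / (∫ u, Real.exp (-(β * ((N : ℝ) - ((u : Matrix.unitaryGroup (Fin N) ℂ) :
            Matrix (Fin N) (Fin N) ℂ).trace.re))) ∂(haarProbability (Matrix.unitaryGroup (Fin N) ℂ)))|) ∧
      HasAreaLawState μ (fun g => normalisedCharacter N (unitaryFundamentalRep (Fin N) ℂ g)) := by
  obtain ⟨μ, -, hlimit, huniq, -, -⟩ := exists_infiniteVolumeLimit_two (unitaryFundamentalRep (Fin N) ℂ)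
    (continuous_unitaryFundamentalRep (Fin N) ℂ) β
  have hμ : μ ∈ infiniteVolumeLimitPoints (unitaryFundamentalRep (Fin N) ℂ) β :=
    hlimit.mem_infiniteVolumeLimitPoints
  exact ⟨μ, hlimit, huniq, fun R T hR hT => unitary_rectExpectation_eq N β hμ hR hT,
    unitary_isConfining N hβ hμ, unitary_hasStringTension N hβ hμ, unitary_hasStringTension' N hβ hμ,
    unitary_hasAreaLawState N hβ hμ⟩

end Unitary

end Summit.Ventures.LatticeQCDFlow.Scoring
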